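import Summits.ABC.IUTFork.Cor312VolumesRealAssembly
import Literature.IUT.LogVolume.TensorPacketMeasureModulus
import HarnessLib

/-!
# Branch E TEST vs S — VOLUME CHARACTERS AT THE REAL CARRIERS for an ARBITRARY `ℚ_p`-linear "Ism"
# (input of the volume-character dichotomy X-12 at the real level; abc-iut-E-t43)

Record file of the abc-iut cell, block E (rung LADDER-ABC:A2.E; seat abc-iut-E-t43; plan/E/E-LOCATION.md §L1 «Real level:
at `Thm311.Real.logShells` `ism` is a BINDER (Y₁ undecided)»; OBJECTS X-12). PROOF-ONLY over abc-iut-c312-5's verbatim volume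
container (`Cor312Vol.SummandPieces`, `Real.summandPiecesDH`, `Real.padicPresentationDH`: Cor312VolumesSummands /
Cor312VolumesPadicSummands / Cor312VolumesRealDH / Cor312VolumesRealAssembly) and the Haar-modulus file
`Literature/IUT/LogVolume/TensorPacketMeasureModulus.lean` (abc-iut-E-t43): 0 new definitions, nothing asserted. **No side is
taken** on [IUTchIII] Cor. 3.12 or on any author; typed ≠ proved ≠ endorsed.

## WHAT IS PROVED

§1 (any summand container `V`, any packet `(j, v_ℚ)`): a packet automorphism `Φ` intertwined by the comparison `e` with a
SUMMANDWISE family of bijections `ψ_{v⃗}` of the summands `M_{v⃗}`, each carrying admissible sets to admissible sets with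
log-measure shifted by a constant `χ_{v⃗}` («summand character»), transports admissibility both ways and shifts the packet
log-volume of every admissible region by the constant `Σ_{v⃗} w_{v⃗}·χ_{v⃗}` — the VOLUME CHARACTER of `Φ` at `(j, v_ℚ)`
(`adm_iff_and_logvol_add_of_summandwise`). The measure-preserving case `χ ≡ 0` is abc-iut-c312-5's
`PreservesRegions.summandwise` + `adm_image_iff` / `logvol_image_eq`; in general a container-PRESERVING `Ψ` gives character `0`
(`adm_iff_and_logvol_add_zero_of_preservesRegions`).

§2 (THE REAL PRIME PACKETS `F_{v_0} ⊗_{ℚ_p} ⋯ ⊗_{ℚ_p} F_{v_j}` of Dupuy–Hilado Def. 3.6.1, c312-5's `padicPresentationDH` at `v_ℚ = p`):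
EVERY factor-and-summand-wise family `⊗_i ⊕_v g_{i,v}` of `ℚ`-linear automorphisms of the completions `K_v` that are
`ℚ_p`-LINEAR in the p-adic coordinates (`hg'`; NO lattice / log-shell condition — this covers Mochizuki's «Ism» isometries,
Dupuy–Hilado's lattice automorphisms `ismDH`, AND Joshi's valuation-rescaling «ℚ_p-linear isomorphisms σ» of [J-III] §8.11.1
p.91 l.38–46 read on `K_v`) acts on the verbatim container with a VOLUME CHARACTER: admissibility both ways, and
`logvol(Φ·A) = logvol(A) + Σ_{v⃗} w_{v⃗}·log μ̄_{v⃗}((⊗_a g'_{a,v⃗ a})((R_I)^∼))` for every admissible `A`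
(`realDH_factorwise_character`) — by §1 with the summand maps `⊗_{a,ℚ_p} g'_{a,v⃗(a)}` (c312-5's intertwining on pure tensors)
and the Haar MODULUS of a `ℚ_p`-linear automorphism of a tensor packet (`packetLogμ_image_linearEquiv`).

Consequence (the sequel `Joshi/TestRealIsmDichotomy.lean`): for the real carriers `Thm311.Real.logShells X logv Aut Ism` with ANY
`ℚ_p`-linear strip-automorphism / Ism binders, every (Ind1)/(Ind2) generator has a volume character at every packet, so the
volume-character dichotomy `Joshi.not_indCoversQ_or_not_statement` (p431585) applies unconditionally: at the real level the
binder `ism` is DECIDED EITHER WAY — isometric at the honest packet ⇒ S unreachable by indeterminacy moves; rescaling ⇒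
`−|log(Θ)| = ⊤` as typed. [claim: Mochizuki2012, status: disputed] [claim: Joshi2024ATS3, status: disputed]
[cite: DupuyHilado2025, Def. 3.6.1, §4.9] [cite: MochizukiAbsTopIII2015, Prop. 5.7 (i)(b) p. 138]. Standard axioms only; no `sorry`.
-/

noncomputable section

open Set Function

namespace Summit.ABC.IUTFork.Joshi

open Thm311 Cor312 Cor312Vol Literature.IUT.LogThetaLattice Literature.IUT.LogVolume

/-! ## 1. Summandwise families with summand characters -/

section Summandwise

variable {T : ThetaIndex} {L : LogShells T} {V : SummandPieces L} {j : T.Label} {vQ : T.VQ}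

/-- **Forward transport along a summandwise family with characters**: if `e ∘ Φ = (Π_{v⃗} ψ_{v⃗}) ∘ e` with bijections `ψ_{v⃗}`
carrying admissible sets to admissible sets of log-measure `+ χ_{v⃗}`, then `Φ` carries an admissible region `A` to an admissible
region of log-volume `logvol(A) + Σ_{v⃗} w_{v⃗}·χ_{v⃗}`. [folklore] -/
theorem adm_and_logvol_add_of_summandwise (ψ : ∀ e, V.X j vQ e ≃ V.X j vQ e) (χ : V.E j vQ → ℝ)
    (hadm : ∀ e (R : Set (V.X j vQ e)), V.adm j vQ e R → V.adm j vQ e (ψ e '' R))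
    (hvol : ∀ e (R : Set (V.X j vQ e)), V.adm j vQ e R → V.logμ j vQ e (ψ e '' R) = V.logμ j vQ e R + χ e)
    {Φ : L.Packet j vQ → L.Packet j vQ} (h : ∀ x, V.e j vQ (Φ x) = Pi.map (fun e => ⇑(ψ e)) (V.e j vQ x))
    {A : Set (L.Packet j vQ)} (hA : V.Adm j vQ A) :
    V.Adm j vQ (Φ '' A) ∧ V.logvol j vQ (Φ '' A) = V.logvol j vQ A + ∑ e, V.w j vQ e * χ e := by
  obtain ⟨R, hR, hRadm⟩ := hA
  have hΦA : V.e j vQ '' (Φ '' A) = Set.pi univ fun e => ψ e '' R e := by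
    rw [SummandPieces.image_image_of_semiconj h, hR]
    exact Set.piMap_image_univ_pi (fun e => ⇑(ψ e)) R
  refine ⟨⟨_, hΦA, fun e => hadm e _ (hRadm e)⟩, ?_⟩
  rw [SummandPieces.logvol_eq_of_pi hΦA (fun e => hadm e _ (hRadm e)), SummandPieces.logvol_eq_of_pi hR hRadm,
    ← Finset.sum_add_distrib]
  exact Finset.sum_congr rfl fun e _ => by rw [hvol e _ (hRadm e), mul_add]

/-- The inverse family intertwines the inverse automorphism. [folklore] -/
theorem summandwise_semiconj_symm (ψ : ∀ e, V.X j vQ e ≃ V.X j vQ e) {Φ : L.Packet j vQ ≃ₗ[ℚ] L.Packet j vQ}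
    (h : ∀ x, V.e j vQ (Φ x) = Pi.map (fun e => ⇑(ψ e)) (V.e j vQ x)) (x : L.Packet j vQ) :
    V.e j vQ (Φ.symm x) = Pi.map (fun e => ⇑(ψ e).symm) (V.e j vQ x) := by
  funext e
  have hx := congr_fun (h (Φ.symm x)) e
  rw [LinearEquiv.apply_symm_apply] at hx
  simp only [Pi.map_apply] at hx ⊢
  rw [hx, Equiv.symm_apply_apply]

/-- The inverse summand maps have the opposite characters. [folklore] -/
theorem summandwise_symm_character (ψ : ∀ e, V.X j vQ e ≃ V.X j vQ e) (χ : V.E j vQ → ℝ)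
    (hadm : ∀ e (R : Set (V.X j vQ e)), V.adm j vQ e (ψ e '' R) ↔ V.adm j vQ e R)
    (hvol : ∀ e (R : Set (V.X j vQ e)), V.adm j vQ e R → V.logμ j vQ e (ψ e '' R) = V.logμ j vQ e R + χ e) :
    (∀ e (R : Set (V.X j vQ e)), V.adm j vQ e R → V.adm j vQ e ((ψ e).symm '' R)) ∧
      ∀ e (R : Set (V.X j vQ e)), V.adm j vQ e R →
        V.logμ j vQ e ((ψ e).symm '' R) = V.logμ j vQ e R + -χ e := by
  have hsymm : ∀ e (R : Set (V.X j vQ e)), V.adm j vQ e R → V.adm j vQ e ((ψ e).symm '' R) := fun e R hR => by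
    rw [← hadm e ((ψ e).symm '' R), Equiv.image_symm_image]; exact hR
  refine ⟨hsymm, fun e R hR => ?_⟩
  have h := hvol e ((ψ e).symm '' R) (hsymm e R hR)
  rw [Equiv.image_symm_image] at h
  linarith

/-- **Summandwise families with characters, both ways — `adm_iff_and_logvol_add_of_summandwise`**: for a packet
AUTOMORPHISM `Φ` intertwined with `Π_{v⃗} ψ_{v⃗}` as above (admissibility of the summands preserved both ways), and line data `D`
realising the container: `Φ` transports admissibility both ways and shifts the log-volume of every admissible region by the constant
`Σ_{v⃗} w_{v⃗}·χ_{v⃗}` — `Φ` HAS A VOLUME CHARACTER at `(j, v_ℚ)`. [folklore] -/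
theorem adm_iff_and_logvol_add_of_summandwise (ψ : ∀ e, V.X j vQ e ≃ V.X j vQ e) (χ : V.E j vQ → ℝ)
    (hadm : ∀ e (R : Set (V.X j vQ e)), V.adm j vQ e (ψ e '' R) ↔ V.adm j vQ e R)
    (hvol : ∀ e (R : Set (V.X j vQ e)), V.adm j vQ e R → V.logμ j vQ e (ψ e '' R) = V.logμ j vQ e R + χ e)
    {Φ : L.Packet j vQ ≃ₗ[ℚ] L.Packet j vQ} (h : ∀ x, V.e j vQ (Φ x) = Pi.map (fun e => ⇑(ψ e)) (V.e j vQ x))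
    {D : MRData L} (hD : V.Realizes D) :
    (∀ A : Set (L.Packet j vQ), D.Adm j vQ A ↔ D.Adm j vQ (Φ '' A)) ∧
      ∀ A : Set (L.Packet j vQ), D.Adm j vQ A →
        D.logvol j vQ (Φ '' A) = D.logvol j vQ A + ∑ e, V.w j vQ e * χ e := by
  obtain ⟨hadm', hvol'⟩ := summandwise_symm_character ψ χ hadm hvol
  have hback : ∀ B : Set (L.Packet j vQ), (Φ.symm : L.Packet j vQ → L.Packet j vQ) '' ((Φ : _ → _) '' B) = B :=
    fun B => by rw [Set.image_image]; exact (Set.image_congr' fun x => Φ.symm_apply_apply x).trans (Set.image_id B)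
  refine ⟨fun A => ?_, fun A hA => ?_⟩
  · rw [hD.adm_iff, hD.adm_iff]
    refine ⟨fun hA => (adm_and_logvol_add_of_summandwise ψ χ (fun e R hR => (hadm e R).2 hR) hvol h hA).1,
      fun hA => ?_⟩
    have := (adm_and_logvol_add_of_summandwise (fun e => (ψ e).symm) (fun e => -χ e) hadm' hvol'
      (summandwise_semiconj_symm ψ h) hA).1
    rwa [hback] at this
  · rw [hD.logvol_eq, hD.logvol_eq]
    exact (adm_and_logvol_add_of_summandwise ψ χ (fun e R hR => (hadm e R).2 hR) hvol h ((hD.adm_iff _ _ _).1 hA)).2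

/-- **A container-PRESERVING intertwiner gives character `0`** (abc-iut-c312-5's `adm_image_iff` / `logvol_image_eq`, repackaged
in character form). [folklore] -/
theorem adm_iff_and_logvol_add_zero_of_preservesRegions {Ψ : (∀ e, V.X j vQ e) → ∀ e, V.X j vQ e}
    (hΨ : V.PreservesRegions j vQ Ψ) {Φ : L.Packet j vQ ≃ₗ[ℚ] L.Packet j vQ}
    (h : ∀ x, V.e j vQ (Φ x) = Ψ (V.e j vQ x)) {D : MRData L} (hD : V.Realizes D) :
    (∀ A : Set (L.Packet j vQ), D.Adm j vQ A ↔ D.Adm j vQ (Φ '' A)) ∧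
      ∀ A : Set (L.Packet j vQ), D.Adm j vQ A → D.logvol j vQ (Φ '' A) = D.logvol j vQ A + 0 := by
  refine ⟨fun A => ?_, fun A hA => ?_⟩
  · rw [hD.adm_iff, hD.adm_iff, SummandPieces.adm_image_iff hΨ h]
  · rw [hD.logvol_eq, hD.logvol_eq, add_zero]
    exact SummandPieces.logvol_image_eq hΨ h ((hD.adm_iff _ _ _).1 hA)

end Summandwise

/-! ## 2. The real prime packets: every `ℚ_p`-linear factor-and-summand-wise family has a volume character -/

section RealDH

open Thm311.Real

variable {F : Type} [Field F] [NumberField F] (X : PilotData F) {logv : PadicLogs F} (hlog : LogvAnalytic logv)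
  (p : ℕ) [hp : Fact p.Prime] {j : (thetaIndex X).Label}

/-- **Intertwining on the real prime packets** (abc-iut-c312-5's naturality square, without any log-shell condition): for a
factor-and-summand-wise family `⊗_i ⊕_v g_{i,v}` whose members are `ℚ_p`-linear in the p-adic coordinates `φ_v : log(𝒟⊢_v) ≃ K̂_v`
(`g' ∘ φ = φ ∘ g`), the comparison `e` of the Dupuy–Hilado presentation intertwines it with the SUMMANDWISE family of `ℚ_p`-linear
automorphisms `⊗_{a,ℚ_p} g'_{a,v⃗(a)}` of the summands `X_{v⃗} = K_{v⃗ 0} ⊗_{ℚ_p} ⋯ ⊗_{ℚ_p} K_{v⃗ j}`. [cite: DupuyHilado2025, Def. 3.6.1] -/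
theorem realDH_comparison_factorwise
    (g : (thetaIndex X).Caps j → ∀ v : (thetaIndex X).Fibre (Sum.inr (ratPrime p) : (thetaIndex X).VQ),
      (logShellsDH X logv).carrier v.1 ≃ₗ[ℚ] (logShellsDH X logv).carrier v.1)
    (g' : (thetaIndex X).Caps j → ∀ v : (thetaIndex X).Fibre (Sum.inr (ratPrime p) : (thetaIndex X).VQ),
      (padicPresentationDH X p logv (hlog (ratPrime p))).k v ≃ₗ[ℚ_[p]]
        (padicPresentationDH X p logv (hlog (ratPrime p))).k v)
    (hg' : ∀ i v x, (padicPresentationDH X p logv (hlog (ratPrime p))).φ v (g i v x) =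
      g' i v ((padicPresentationDH X p logv (hlog (ratPrime p))).φ v x))
    (x : (logShellsDH X logv).Packet j (Sum.inr (ratPrime p))) :
    (padicPresentationDH X p logv (hlog (ratPrime p))).comparison j
        ((logShellsDH X logv).factorwise j _ (fun i => (logShellsDH X logv).summandwise _ (g i)) x) =
      Pi.map (fun e => ⇑((PiTensorProduct.congr fun a => g' a (e a) :
          (padicPresentationDH X p logv (hlog (ratPrime p))).X e ≃ₗ[ℚ_[p]]
            (padicPresentationDH X p logv (hlog (ratPrime p))).X e).toEquiv))
        ((padicPresentationDH X p logv (hlog (ratPrime p))).comparison j x) := by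
  funext e
  -- naturality: two `ℚ`-linear maps agreeing on pure tensors (c312-5's argument)
  have key : (LinearMap.proj e ∘ₗ (padicPresentationDH X p logv (hlog (ratPrime p))).comparison j) ∘ₗ
        ((logShellsDH X logv).factorwise j _ (fun i => (logShellsDH X logv).summandwise _ (g i))).toLinearMap =
      ((PiTensorProduct.congr fun a => g' a (e a) :
          (padicPresentationDH X p logv (hlog (ratPrime p))).X e ≃ₗ[ℚ_[p]]
            (padicPresentationDH X p logv (hlog (ratPrime p))).X e).toLinearMap.restrictScalars ℚ) ∘ₗ
        (LinearMap.proj e ∘ₗ (padicPresentationDH X p logv (hlog (ratPrime p))).comparison j) := by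
    refine PiTensorProduct.ext (MultilinearMap.ext fun y => ?_)
    simp only [LinearMap.compMultilinearMap_apply]
    change (padicPresentationDH X p logv (hlog (ratPrime p))).comparison j
        ((logShellsDH X logv).factorwise j _ (fun i => (logShellsDH X logv).summandwise _ (g i))
          ((logShellsDH X logv).tprod j _ y)) e =
      (PiTensorProduct.congr fun a => g' a (e a) :
          (padicPresentationDH X p logv (hlog (ratPrime p))).X e ≃ₗ[ℚ_[p]]
            (padicPresentationDH X p logv (hlog (ratPrime p))).X e)
        ((padicPresentationDH X p logv (hlog (ratPrime p))).comparison j (PiTensorProduct.tprod ℚ y) e)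
    rw [(logShellsDH X logv).factorwise_summandwise_tprod]
    change (padicPresentationDH X p logv (hlog (ratPrime p))).comparison j
        (PiTensorProduct.tprod ℚ fun i => fun v => g i v (y i v)) e = _
    rw [PadicPresentation.comparison_tprod, PadicPresentation.comparison_tprod]
    simp only [PiTensorProduct.congr_tprod]
    exact congrArg _ (funext fun a => hg' a (e a) (y a (e a)))
  exact LinearMap.congr_fun key x

/-- **Every `ℚ_p`-linear factor-and-summand-wise family has a VOLUME CHARACTER on the real prime packets — `realDH_factorwise_character`.**
For line data `D` realising abc-iut-c312-5's verbatim container `summandPiecesDH` of the real Dupuy–Hilado-level log-shells and ANY family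
`g_{i,v}` of `ℚ`-linear automorphisms of the `K_v`, `v | p`, that are `ℚ_p`-linear in the p-adic coordinates: the packet automorphism
`⊗_i ⊕_v g_{i,v}` of `𝓘^ℚ(^{S^±_{j+1}};𝒟^⊢_p)` transports admissibility both ways and
`logvol(Φ·A) = logvol(A) + Σ_{v⃗} w_{v⃗}·log μ̄_{v⃗}((⊗_a g'_{a,v⃗ a})((R_I)^∼))` for every admissible `A` (the summand characters are the
Haar MODULI of the `ℚ_p`-linear automorphisms `⊗_a g'_{a,v⃗ a}`, `packetLogμ_image_linearEquiv`). Isometries / lattice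
automorphisms have character `0`; valuation-rescalings do not. [cite: DupuyHilado2025, Def. 3.6.1, §4.9]
[cite: MochizukiAbsTopIII2015, Prop. 5.7 (i)(b) p. 138] -/
theorem realDH_factorwise_character
    (g : (thetaIndex X).Caps j → ∀ v : (thetaIndex X).Fibre (Sum.inr (ratPrime p) : (thetaIndex X).VQ),
      (logShellsDH X logv).carrier v.1 ≃ₗ[ℚ] (logShellsDH X logv).carrier v.1)
    (g' : (thetaIndex X).Caps j → ∀ v : (thetaIndex X).Fibre (Sum.inr (ratPrime p) : (thetaIndex X).VQ),
      (padicPresentationDH X p logv (hlog (ratPrime p))).k v ≃ₗ[ℚ_[p]]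
        (padicPresentationDH X p logv (hlog (ratPrime p))).k v)
    (hg' : ∀ i v x, (padicPresentationDH X p logv (hlog (ratPrime p))).φ v (g i v x) =
      g' i v ((padicPresentationDH X p logv (hlog (ratPrime p))).φ v x))
    {D : MRData (logShellsDH X logv)} (hD : (summandPiecesDH X hlog).Realizes D) :
    (∀ A : Set ((logShellsDH X logv).Packet j (Sum.inr (ratPrime p))),
        D.Adm j _ A ↔ D.Adm j _ ((logShellsDH X logv).factorwise j _ (fun i => (logShellsDH X logv).summandwise _ (g i)) '' A)) ∧
      ∀ A : Set ((logShellsDH X logv).Packet j (Sum.inr (ratPrime p))), D.Adm j _ A →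
        D.logvol j _ ((logShellsDH X logv).factorwise j _ (fun i => (logShellsDH X logv).summandwise _ (g i)) '' A) =
          D.logvol j _ A + ∑ e : (summandPiecesDH X hlog).E j (Sum.inr (ratPrime p)),
            (padicPresentationDH X p logv (hlog (ratPrime p))).w j e *
              packetLogμ p ((padicPresentationDH X p logv (hlog (ratPrime p))).kk e)
                ((PiTensorProduct.congr fun a => g' a (e a) :
                    (padicPresentationDH X p logv (hlog (ratPrime p))).X e ≃ₗ[ℚ_[p]]
                      (padicPresentationDH X p logv (hlog (ratPrime p))).X e) ''
                  (normalizedPacket p ((padicPresentationDH X p logv (hlog (ratPrime p))).kk e) :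
                    Set ((padicPresentationDH X p logv (hlog (ratPrime p))).X e))) :=
  adm_iff_and_logvol_add_of_summandwise (V := summandPiecesDH X hlog) (j := j)
    (vQ := (Sum.inr (ratPrime p) : (thetaIndex X).VQ))
    (fun e => ((PiTensorProduct.congr fun a => g' a (e a) :
        (padicPresentationDH X p logv (hlog (ratPrime p))).X e ≃ₗ[ℚ_[p]]
          (padicPresentationDH X p logv (hlog (ratPrime p))).X e)).toEquiv)
    (fun e => packetLogμ p ((padicPresentationDH X p logv (hlog (ratPrime p))).kk e)
        ((PiTensorProduct.congr fun a => g' a (e a) :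
            (padicPresentationDH X p logv (hlog (ratPrime p))).X e ≃ₗ[ℚ_[p]]
              (padicPresentationDH X p logv (hlog (ratPrime p))).X e) ''
          (normalizedPacket p ((padicPresentationDH X p logv (hlog (ratPrime p))).kk e) :
            Set ((padicPresentationDH X p logv (hlog (ratPrime p))).X e))))
    (fun e R => packetAdm_image_linearEquiv_iff p ((padicPresentationDH X p logv (hlog (ratPrime p))).kk e)
        (PiTensorProduct.congr fun a => g' a (e a)) R)
    (fun e R hR => by
      rw [add_comm]
      exact packetLogμ_image_linearEquiv p ((padicPresentationDH X p logv (hlog (ratPrime p))).kk e)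
        (PiTensorProduct.congr fun a => g' a (e a)) hR)
    (realDH_comparison_factorwise X hlog p g g' hg') hD

end RealDH

end Summit.ABC.IUTFork.Joshi

end
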